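import Mathlib
import HarnessLib
import Summits.Ventures.LatticeQCDFlow.Exactness.SU2AxisChart
import Summits.Ventures.LatticeQCDFlow.Exactness.CreutzSampler

/-!
# The SU(2) link heat bath of `latflow.core`, every random draw included, is exact

HONEST FRAMING: exact (Metropolis-corrected) sampling algorithms for lattice gauge theory;
figures of merit are autocorrelation/cost numbers at stated couplings and volumes; no
continuum-physics claim.

Venture `LatticeQCDFlow` (cell pub-lqcd), topic `Exactness`, FANOUT row 9 (eng-latcore, the
engine `latflow.core`).  NEW WORK of the cell: the one-line assembly of row 9's gen-11 files —
`KennedyPendletonSampler.lean` / `CreutzSampler.lean` (the `a₀` loops from uniforms output the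
normalised A3 law), `SU2AxisChart.lean` (the axis chart from two uniforms outputs `uniformSphere`)
and gen-9's `SU2HeatBathSampler.lean` (assembling A3's `a₀` with a uniform axis gives the link law).
Nothing is cited as a fact.  Printed counterparts, NAMED ONLY: Creutz 1980; Kennedy–Pendleton 1985;
Gattringer–Lang 2010 §4.1.3.

THE STATEMENT.  `csrc/latcore_template.c` `update_link` (heat-bath mode) draws, per SU(2)
subgroup hit with `bt = 2βk/N > 0`: `a₀` by the Kennedy–Pendleton loop (`bt ≥ 2`) or the Creutz
loop (`bt < 2`), then `cth = 2u − 1`, `φ = 2πu′`, the axis `(sth cos φ, sth sin φ, cth)`, and the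
quaternion `a₀ + √(1−a₀²) n̂·Z⃗`.  In idealised real arithmetic the law of that quaternion is
EXACTLY the normalised one-link heat-bath law `(∫ e^{bt a₀} dHaar)⁻¹ • e^{bt a₀(U)} dHaar(U)`:
**`map_assembleSU2_kp_axisChart`** (KP branch), **`map_assembleSU2_creutz_axisChart`** (Creutz
branch), and at `bt = 0` (zero staple projection) **`map_assembleSU2_creutz₀_axisChart`** gives Haar.
The staple rotation `a ↦ a ŝ†` that follows is a Haar translation (`CabibboMarinariKernel.lean`).

NOT CLAIMED: floating point; the round caps; the `0 < bt ≤ 10⁻¹²` guard (see `CreutzSampler.lean`).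
-/

namespace Summit.Ventures.LatticeQCDFlow.Exactness

open MeasureTheory Measure Metric Set Real
open scoped ENNReal

/-- **KP branch, from six uniforms per round to the link.**  The Kennedy–Pendleton `a₀` loop, the
axis chart `(2u−1, 2πu′)` and the assembly `a₀ + √(1−a₀²) n̂·Z⃗` produce EXACTLY the normalised
SU(2) one-link heat-bath law (`bt > 0`). -/
theorem map_assembleSU2_kp_axisChart {bt : ℝ} (hbt : 0 < bt) :
    ((loopLaw (kpRound bt)).prod ((unitLaw.prod unitLaw).map axisChart)).map assembleSU2 =
      ((Literature.MathematicalPhysics.QuantumFieldTheory.haarProbability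
          (Matrix.specialUnitaryGroup (Fin 2) ℂ)).withDensity
            (fun U => ENNReal.ofReal (Real.exp (bt * su2a0 U))) univ)⁻¹ •
        (Literature.MathematicalPhysics.QuantumFieldTheory.haarProbability
          (Matrix.specialUnitaryGroup (Fin 2) ℂ)).withDensity
            (fun U => ENNReal.ofReal (Real.exp (bt * su2a0 U))) := by
  rw [map_axisChart_unitLaw, map_assembleSU2_loopLaw_kpRound hbt]

/-- **Creutz branch**: the same conclusion with the Creutz `a₀` loop (`bt > 0`). -/
theorem map_assembleSU2_creutz_axisChart {bt : ℝ} (hbt : 0 < bt) :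
    ((loopLaw (creutzRound bt)).prod ((unitLaw.prod unitLaw).map axisChart)).map assembleSU2 =
      ((Literature.MathematicalPhysics.QuantumFieldTheory.haarProbability
          (Matrix.specialUnitaryGroup (Fin 2) ℂ)).withDensity
            (fun U => ENNReal.ofReal (Real.exp (bt * su2a0 U))) univ)⁻¹ •
        (Literature.MathematicalPhysics.QuantumFieldTheory.haarProbability
          (Matrix.specialUnitaryGroup (Fin 2) ℂ)).withDensity
            (fun U => ENNReal.ofReal (Real.exp (bt * su2a0 U))) := by
  rw [map_axisChart_unitLaw, map_assembleSU2_loopLaw_creutzRound hbt]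

/-- **Zero staple projection** (`bt = 0`): the `2r − 1` loop, the axis chart and the assembly
produce EXACTLY the Haar probability measure of SU(2). -/
theorem map_assembleSU2_creutz₀_axisChart :
    ((loopLaw creutzRound₀).prod ((unitLaw.prod unitLaw).map axisChart)).map assembleSU2 =
      Literature.MathematicalPhysics.QuantumFieldTheory.haarProbability
        (Matrix.specialUnitaryGroup (Fin 2) ℂ) := by
  rw [map_axisChart_unitLaw, map_assembleSU2_loopLaw_creutzRound₀]

end Summit.Ventures.LatticeQCDFlow.Exactness
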